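import Summits.RiemannHypothesis.RiemannHypothesis.Theses.SpectralTrace
import Literature.NumberTheory.LFunctions.WeilArchimedeanMoments
import HarnessLib

/-!
# `WindowTraceArch` — low forbidden zone, II: the triangle `Λ_b` and its transform

Second file of the negative lemma (see `…/Negative/LowZone.lean`): the triangle
`Λ_b(u) = max (b - |u|) 0`, its transform `Λ̂_b(s) = (e^{bz} + e^{-bz} - 2)/z²`, `z = s - 1/2`
(`weilMellin_tri`), the Fejér form `Λ̂_b(1/2 + it) = b² sinc²(bt/2)` on the critical line
(`weilMellin_tri_line`) and the strip bound `‖Λ̂_b(s)‖ ≤ (2e^{b/2} + 2)/(Im s)²`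
(`norm_weilMellin_tri_le`).
-/

noncomputable section

open Complex Filter Set MeasureTheory
open scoped Real Topology ComplexConjugate ContDiff

namespace Summit.RiemannHypothesis.RiemannHypothesis.Theorems.WindowTraceArch.Negative.LowZone

open Literature.NumberTheory.LFunctions
open Literature.NumberTheory.LFunctions.ZetaZeros (riemannZetaNontrivialZeros)

/-! ## §C The test function, I: the triangle `Λ_b` and its transform -/

section Triangle

/-- The triangle `Λ_b(u) = max (b - |u|) 0`, as a complex-valued function. -/
def tri (b : ℝ) (u : ℝ) : ℂ := ((max (b - |u|) 0 : ℝ) : ℂ)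

/-- The triangle is continuous. [folklore] -/
theorem continuous_tri (b : ℝ) : Continuous (tri b) :=
  Complex.continuous_ofReal.comp ((continuous_const.sub continuous_abs).max continuous_const)

/-- Inside `[-b, b]` the triangle is `b - |u|`. [folklore] -/
theorem tri_of_abs_le {b u : ℝ} (h : |u| ≤ b) : tri b u = ((b - |u| : ℝ) : ℂ) := by
  simp [tri, max_eq_left (sub_nonneg.2 h)]

/-- Outside `(-b, b)` the triangle vanishes. [folklore] -/
theorem tri_of_le_abs {b u : ℝ} (h : b ≤ |u|) : tri b u = 0 := by
  simp [tri, max_eq_right (sub_nonpos.2 h)]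

/-- The triangle is bounded by its height `b`. [folklore] -/
theorem norm_tri_le {b : ℝ} (hb : 0 ≤ b) (u : ℝ) : ‖tri b u‖ ≤ b := by
  rw [tri, Complex.norm_real, Real.norm_eq_abs, abs_of_nonneg (le_max_right _ _)]
  exact max_le (by linarith [abs_nonneg u]) hb

/-- The support of the triangle lies in `[-b, b]`. [folklore] -/
theorem support_tri_subset (b : ℝ) : Function.support (tri b) ⊆ Icc (-b) b := by
  intro u hu
  by_contra h
  apply hu
  apply tri_of_le_abs
  rw [mem_Icc, not_and_or, not_le, not_le] at h
  rcases h with h | h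
  · linarith [neg_le_abs u]
  · linarith [le_abs_self u]

/-- The topological support of the triangle lies in `[-b, b]`. [folklore] -/
theorem tsupport_tri_subset (b : ℝ) : tsupport (tri b) ⊆ Icc (-b) b :=
  closure_minimal (support_tri_subset b) isClosed_Icc

/-- The triangle has compact support. [folklore] -/
theorem hasCompactSupport_tri (b : ℝ) : HasCompactSupport (tri b) :=
  HasCompactSupport.of_support_subset_isCompact isCompact_Icc (support_tri_subset b)

/-- Antiderivative on `[0, b]`: `d/du [((b-u)z+1) e^{zu} / z²] = (b-u) e^{zu}`. [folklore] -/
theorem hasDerivAt_triPrim₁ (b : ℝ) {z : ℂ} (hz : z ≠ 0) (u : ℝ) :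
    HasDerivAt (fun u : ℝ => (((b : ℂ) - u) * z + 1) * cexp (z * u) / z ^ 2)
      (((b : ℂ) - u) * cexp (z * u)) u := by
  have hu : HasDerivAt (fun u : ℝ => (u : ℂ)) 1 u := (hasDerivAt_id u).ofReal_comp
  have h1 : HasDerivAt (fun u : ℝ => ((b : ℂ) - u) * z + 1) (-z) u := by
    have := ((hu.const_sub (b : ℂ)).mul_const z).add_const 1
    simpa using this
  have h2 : HasDerivAt (fun u : ℝ => cexp (z * u)) (z * cexp (z * u)) u := by
    have := (hu.const_mul z).cexp
    simpa [mul_comm] using this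
  refine ((h1.mul h2).div_const (z ^ 2)).congr_deriv ?_
  field_simp
  ring

/-- Antiderivative on `[-b, 0]`: `d/du [((b+u)z-1) e^{zu} / z²] = (b+u) e^{zu}`. [folklore] -/
theorem hasDerivAt_triPrim₂ (b : ℝ) {z : ℂ} (hz : z ≠ 0) (u : ℝ) :
    HasDerivAt (fun u : ℝ => (((b : ℂ) + u) * z - 1) * cexp (z * u) / z ^ 2)
      (((b : ℂ) + u) * cexp (z * u)) u := by
  have hu : HasDerivAt (fun u : ℝ => (u : ℂ)) 1 u := (hasDerivAt_id u).ofReal_comp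
  have h1 : HasDerivAt (fun u : ℝ => ((b : ℂ) + u) * z - 1) z u := by
    have := ((hu.const_add (b : ℂ)).mul_const z).sub_const 1
    simpa using this
  have h2 : HasDerivAt (fun u : ℝ => cexp (z * u)) (z * cexp (z * u)) u := by
    have := (hu.const_mul z).cexp
    simpa [mul_comm] using this
  refine ((h1.mul h2).div_const (z ^ 2)).congr_deriv ?_
  field_simp
  ring

/-- **Transform of the triangle**: for `z = s - 1/2 ≠ 0`,
`Λ̂_b(s) = (e^{bz} + e^{-bz} - 2)/z²`. [folklore] -/
theorem weilMellin_tri {b : ℝ} (hb : 0 ≤ b) {s : ℂ} (hs : s - 1 / 2 ≠ 0) :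
    weilMellin (tri b) s =
      (cexp ((s - 1 / 2) * b) + cexp (-((s - 1 / 2) * b)) - 2) / (s - 1 / 2) ^ 2 := by
  have hz : s - 1 / 2 ≠ 0 := hs
  unfold weilMellin
  rw [integral_eq_intervalIntegral_of_tsupport (continuous_tri b) (tsupport_tri_subset b)]
  have hint : ∀ c d : ℝ, IntervalIntegrable (fun u : ℝ => tri b u * cexp ((s - 1 / 2) * u)) volume c d :=
    fun c d => ((continuous_tri b).mul (by fun_prop)).intervalIntegrable _ _
  rw [← intervalIntegral.integral_add_adjacent_intervals (hint (-b) 0) (hint 0 b)]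
  -- the piece `[-b, 0]`
  have hL : ∫ u in (-b)..0, tri b u * cexp ((s - 1 / 2) * u) =
      ∫ u in (-b)..0, ((b : ℂ) + u) * cexp ((s - 1 / 2) * u) := by
    refine intervalIntegral.integral_congr fun u hu => ?_
    rw [uIcc_of_le (by linarith), mem_Icc] at hu
    have habs : |u| = -u := abs_of_nonpos hu.2
    rw [tri_of_abs_le (by rw [habs]; linarith), habs]
    push_cast
    ring_nf
  have hR : ∫ u in (0 : ℝ)..b, tri b u * cexp ((s - 1 / 2) * u) =
      ∫ u in (0 : ℝ)..b, ((b : ℂ) - u) * cexp ((s - 1 / 2) * u) := by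
    refine intervalIntegral.integral_congr fun u hu => ?_
    rw [uIcc_of_le hb, mem_Icc] at hu
    have habs : |u| = u := abs_of_nonneg hu.1
    rw [tri_of_abs_le (by rw [habs]; linarith), habs]
    push_cast
    ring_nf
  rw [hL, hR]
  rw [intervalIntegral.integral_eq_sub_of_hasDerivAt (fun u _ => hasDerivAt_triPrim₂ b hz u)
      ((Continuous.continuousOn (by fun_prop)).intervalIntegrable),
    intervalIntegral.integral_eq_sub_of_hasDerivAt (fun u _ => hasDerivAt_triPrim₁ b hz u)
      ((Continuous.continuousOn (by fun_prop)).intervalIntegrable)]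
  simp only [Complex.ofReal_neg, Complex.ofReal_zero, mul_zero, Complex.exp_zero, mul_one, add_zero,
    sub_zero, mul_neg]
  field_simp
  ring_nf

/-- The transform of the triangle at the centre: `Λ̂_b(1/2) = b²`. [folklore] -/
theorem weilMellin_tri_half {b : ℝ} (hb : 0 ≤ b) : weilMellin (tri b) (1 / 2) = (b : ℂ) ^ 2 := by
  unfold weilMellin
  rw [integral_eq_intervalIntegral_of_tsupport (continuous_tri b) (tsupport_tri_subset b)]
  simp only [sub_self, zero_mul, Complex.exp_zero, mul_one]
  have hint : ∀ c d : ℝ, IntervalIntegrable (tri b) volume c d :=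
    fun c d => (continuous_tri b).intervalIntegrable _ _
  rw [← intervalIntegral.integral_add_adjacent_intervals (hint (-b) 0) (hint 0 b)]
  have hL : ∫ u in (-b)..0, tri b u = ∫ u in (-b)..0, ((b : ℂ) + u) := by
    refine intervalIntegral.integral_congr fun u hu => ?_
    rw [uIcc_of_le (by linarith), mem_Icc] at hu
    have habs : |u| = -u := abs_of_nonpos hu.2
    rw [tri_of_abs_le (by rw [habs]; linarith), habs]
    push_cast
    ring
  have hR : ∫ u in (0 : ℝ)..b, tri b u = ∫ u in (0 : ℝ)..b, ((b : ℂ) - u) := by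
    refine intervalIntegral.integral_congr fun u hu => ?_
    rw [uIcc_of_le hb, mem_Icc] at hu
    have habs : |u| = u := abs_of_nonneg hu.1
    rw [tri_of_abs_le (by rw [habs]; linarith), habs]
    push_cast
    ring
  have hofR : ∀ c d : ℝ, IntervalIntegrable (fun u : ℝ => (u : ℂ)) volume c d :=
    fun c d => Complex.continuous_ofReal.intervalIntegrable _ _
  have i1 : ∫ u in (-b)..0, ((b : ℂ) + u) = (b : ℂ) ^ 2 / 2 := by
    rw [intervalIntegral.integral_add intervalIntegrable_const (hofR _ _),
      intervalIntegral.integral_const, intervalIntegral.integral_ofReal, integral_id]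
    simp only [Complex.real_smul]
    push_cast
    ring
  have i2 : ∫ u in (0 : ℝ)..b, ((b : ℂ) - u) = (b : ℂ) ^ 2 / 2 := by
    rw [intervalIntegral.integral_sub intervalIntegrable_const (hofR _ _),
      intervalIntegral.integral_const, intervalIntegral.integral_ofReal, integral_id]
    simp only [Complex.real_smul]
    push_cast
    ring
  rw [hL, hR, i1, i2]
  ring

/-- On the critical line the transform of the triangle is the Fejér-type kernel
`Λ̂_b(1/2 + it) = b² sinc²(bt/2)` (for all real `t`). [folklore] -/
theorem weilMellin_tri_line {b : ℝ} (hb : 0 ≤ b) (t : ℝ) :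
    weilMellin (tri b) (1 / 2 + t * I) = ((b ^ 2 * Real.sinc (b * t / 2) ^ 2 : ℝ) : ℂ) := by
  rcases eq_or_ne t 0 with rfl | ht
  · have h0 : (1 / 2 : ℂ) + ((0 : ℝ) : ℂ) * I = 1 / 2 := by simp
    rw [h0, weilMellin_tri_half hb]
    simp
  by_cases hb0 : b = 0
  · subst hb0
    have htri : tri 0 = fun _ => 0 := by
      funext u
      simp [tri]
    simp [weilMellin, htri]
  have hz : (1 / 2 + (t : ℂ) * I) - 1 / 2 ≠ 0 := by
    intro h
    have := congrArg Complex.im h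
    simp at this
    exact ht this
  rw [weilMellin_tri hb hz]
  have e1 : (1 / 2 + (t : ℂ) * I - 1 / 2) = (t : ℂ) * I := by ring
  rw [e1]
  have e2 : cexp ((t : ℂ) * I * b) + cexp (-((t : ℂ) * I * b)) = 2 * Complex.cos ((b * t : ℝ) : ℂ) := by
    rw [Complex.two_cos]
    congr 1 <;> congr 1 <;> push_cast <;> ring
  have e3 : ((t : ℂ) * I) ^ 2 = -((t : ℂ) ^ 2) := by
    rw [mul_pow, Complex.I_sq]; ring
  rw [e2, e3, ← Complex.ofReal_cos]
  have hbt : b * t / 2 ≠ 0 := by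
    have : b * t ≠ 0 := mul_ne_zero hb0 ht
    intro h; apply this; linear_combination (2 : ℝ) * h
  have hsinc : Real.sinc (b * t / 2) = Real.sin (b * t / 2) / (b * t / 2) := Real.sinc_of_ne_zero hbt
  have hcos : Real.cos (b * t) = 1 - 2 * Real.sin (b * t / 2) ^ 2 := by
    have := Real.cos_two_mul (b * t / 2)
    have h2 := Real.sin_sq_add_cos_sq (b * t / 2)
    rw [show 2 * (b * t / 2) = b * t by ring] at this
    nlinarith
  rw [hsinc, hcos]
  have ht' : (t : ℂ) ≠ 0 := Complex.ofReal_ne_zero.2 ht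
  have hb' : (b : ℂ) ≠ 0 := Complex.ofReal_ne_zero.2 hb0
  push_cast
  field_simp
  ring

/-- `b² sinc²(bt/2) = 4 sin²(bt/2)/t²` for `t ≠ 0`. [folklore] -/
theorem sq_mul_sinc_sq_eq {b t : ℝ} (ht : t ≠ 0) :
    b ^ 2 * Real.sinc (b * t / 2) ^ 2 = 4 * Real.sin (b * t / 2) ^ 2 / t ^ 2 := by
  by_cases hb : b = 0
  · subst hb; simp
  have hbt : b * t / 2 ≠ 0 := by
    have : b * t ≠ 0 := mul_ne_zero hb ht
    intro h; apply this; linarith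
  rw [Real.sinc_of_ne_zero hbt]
  field_simp
  ring

/-- The Fejér kernel is bounded by `4/t²`. [folklore] -/
theorem sq_mul_sinc_sq_le_div {b t : ℝ} (ht : t ≠ 0) :
    b ^ 2 * Real.sinc (b * t / 2) ^ 2 ≤ 4 / t ^ 2 := by
  rw [sq_mul_sinc_sq_eq ht]
  have h1 : Real.sin (b * t / 2) ^ 2 ≤ 1 := by
    rw [sq_le_one_iff_abs_le_one]; exact Real.abs_sin_le_one _
  have h2 : 0 < t ^ 2 := by positivity
  rw [div_le_div_iff_of_pos_right h2]
  linarith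

/-- **Strip bound for the triangle**: for `0 ≤ Re s ≤ 1`, `Im s ≠ 0`,
`‖Λ̂_b(s)‖ ≤ (2 e^{b/2} + 2)/(Im s)²`. [folklore] -/
theorem norm_weilMellin_tri_le {b : ℝ} (hb : 0 ≤ b) {s : ℂ} (hs0 : 0 ≤ s.re) (hs1 : s.re ≤ 1)
    (hsi : s.im ≠ 0) :
    ‖weilMellin (tri b) s‖ ≤ (2 * Real.exp (b / 2) + 2) / s.im ^ 2 := by
  have hz : s - 1 / 2 ≠ 0 := by
    intro h
    have := congrArg Complex.im h
    simp at this
    exact hsi this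
  rw [weilMellin_tri hb hz, norm_div, norm_pow]
  have hre : |(s - 1 / 2).re| ≤ 1 / 2 := by
    rw [abs_le]; constructor <;> simp <;> linarith
  have him : (s - 1 / 2).im = s.im := by simp
  -- numerator
  have hnum : ‖cexp ((s - 1 / 2) * b) + cexp (-((s - 1 / 2) * b)) - 2‖ ≤ 2 * Real.exp (b / 2) + 2 := by
    have h1 : ‖cexp ((s - 1 / 2) * b)‖ ≤ Real.exp (b / 2) := by
      rw [Complex.norm_exp]
      refine Real.exp_le_exp.2 ?_
      have : ((s - 1 / 2) * (b : ℂ)).re = (s - 1 / 2).re * b := by simp [Complex.mul_re]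
      rw [this]
      nlinarith [abs_le.1 hre]
    have h2 : ‖cexp (-((s - 1 / 2) * b))‖ ≤ Real.exp (b / 2) := by
      rw [Complex.norm_exp]
      refine Real.exp_le_exp.2 ?_
      have : (-((s - 1 / 2) * (b : ℂ))).re = -((s - 1 / 2).re * b) := by simp [Complex.mul_re]
      rw [this]
      nlinarith [abs_le.1 hre]
    calc ‖cexp ((s - 1 / 2) * b) + cexp (-((s - 1 / 2) * b)) - 2‖
        ≤ ‖cexp ((s - 1 / 2) * b)‖ + ‖cexp (-((s - 1 / 2) * b))‖ + ‖(2 : ℂ)‖ := norm_sub_le_of_le (norm_add_le _ _) le_rfl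
      _ ≤ Real.exp (b / 2) + Real.exp (b / 2) + 2 := by
          have : ‖(2 : ℂ)‖ = 2 := by simp
          linarith
      _ = 2 * Real.exp (b / 2) + 2 := by ring
  -- denominator
  have hden : s.im ^ 2 ≤ ‖s - 1 / 2‖ ^ 2 := by
    rw [← him]
    have := Complex.abs_im_le_norm (s - 1 / 2)
    rw [← sq_abs]
    exact pow_le_pow_left₀ (abs_nonneg _) this 2
  have hpos : 0 < s.im ^ 2 := by positivity
  calc ‖cexp ((s - 1 / 2) * b) + cexp (-((s - 1 / 2) * b)) - 2‖ / ‖s - 1 / 2‖ ^ 2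
      ≤ (2 * Real.exp (b / 2) + 2) / ‖s - 1 / 2‖ ^ 2 :=
        div_le_div_of_nonneg_right hnum (by positivity)
    _ ≤ (2 * Real.exp (b / 2) + 2) / s.im ^ 2 :=
        div_le_div_of_nonneg_left (by positivity) hpos hden

end Triangle

end Summit.RiemannHypothesis.RiemannHypothesis.Theorems.WindowTraceArch.Negative.LowZone

end
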